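import Literature.MathematicalPhysics.QuantumFieldTheory.Balaban1983to89.B4Eq19LatticeGradientCampanato

/-!
# `Balaban1983to89.B4Eq19LatticeInteriorGradient` — T. Bałaban, *Propagators and renormalization transformations for lattice gauge theories. II*,
# Commun. Math. Phys. **96** (1984) 223–250 [Balaban1984PropagatorsII] (1.9) p. 226, with *Propagators for lattice gauge theories in a background
# field*, Commun. Math. Phys. **99** (1985) 389–434 [Balaban1985BackgroundPropagators] Thm 3.1 (3.43)₁∕(3.44) p. 398 (the GRADIENT members
# *«‖ζ∇_UG′(U)λ‖_β»*, *«|(∇_UG′(U)∇\*_Uλ)(x)| ≤ B′₀(ε)(…‖λ‖_ε… + |λ|)»*): **THE INTERIOR GRADIENT (`C^{1,½}`) ESTIMATE ON `ℤ^d` FOR DIVERGENCE-FORM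
# HÖLDER DATA, UNIFORM IN THE SCALE** — for `K ≥ 3`, `(−Δ + K⁻²)u = ∂*g` on `Q_{4K}(a)`, `|u| ≤ M_u` there, and `g` `½`-Hölder at scale `K`
# (`|g(y′,μ) − g(y,μ)| ≤ H√(s∕K)` for `y′ ∈ Q_s(y)`): `|∂_μu(a)| ≤ C_d(M_u∕K + H)` and `|∂_μu(x′) − ∂_μu(a)| ≤ C_d(M_u∕K + H)√(ρ₀∕K)` for `x′ ∈ Q_{ρ₀}(a)`,
# `1 ≤ ρ₀ ≤ K` ([Giaquinta1984] Ch. III §3 + §1 Thm 1.2 (Campanato ⇒ Hölder), discrete).  In η-units (`η = K⁻¹`, `Δ^η = K²Δ`, `∇^η = K∂`, `g = f∕K`):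
# `‖∇^η u‖ ≤ C_d(‖u‖_∞ + H_f)` for `(Δ^η + 1)u = ∇^{η*}f` with `f` η-scale `½`-Hölder of modulus `H_f` — the flat core of the (3.44)-shaped gradient row of
# `(Δ^η_U + 1)⁻¹∇_{U,ν}` on Hölder data, by which STOREY H's covariant Hessian row is to be docked WITHOUT the unsatisfiable Hessian letter (HLb).

statement-level skeleton of published theorems with citation tags; proofs where landed; nothing here is a claim about the Yang–Mills mass gap

CITATION HEADER (lean-in-tree rule).  Audit cell `pub-balaban`, sub-cell `t4`, BINDER row NE9; filed by NE9 crux-team LEAF PROVER 01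
(`b2b-balaban-t4-ne9-formalise-leaf-01`, gen 95; bears_on: R4/N22).  The CONTENT is [folklore] discrete elliptic regularity ([Giaquinta1984] Ch. III §1, §3);
[Balaban1984PropagatorsII] (1.9) ∕ [Balaban1985BackgroundPropagators] (3.43)₁, (3.44) are the printed statements these files serve, nothing of them is asserted
here.  REUSED BY NAME: this lineage's `B4Eq19LatticeGradientCampanato.exists_gradient_campanato_const`, `B4Eq19LatticeBoxMeans` (`boxAvg`, `exc`,
`sq_sub_boxAvg_le_exc`, `card_mul_sq_sub_le_exc`, `card_mul_boxAvg_sq_le`), gen 94's `B4Eq19LatticeInteriorHolder.top_scale_bound`.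

WHAT IS PROVED (sorry-free; proof lane — 0 `def`; [folklore]).
* §1 `sq_sub_boxAvg_le_of_campanato` — Campanato ⇒ pointwise at one centre: `exc v (Q_ρ(z)) ≤ N(ρ+1)^{d+1}` (`0 ≤ ρ ≤ R₀`) ⟹ `(v z − avg_{Q_m(z)}v)² ≤ 64·2^d·N·(m+1)`
  (`m ≤ R₀`; strong induction through `⌊m∕2⌋`, `(a+b)² ≤ (8∕7)a² + 8b²`).
* §2 `sq_sub_le_of_campanato` — two centres: `x′ ∈ Q_{ρ₀}(z)`, `2ρ₀ ≤ R₀`, the Campanato bound at `z` and at `x′` ⟹ `(v x′ − v z)² ≤ 387·2^d·N·(2ρ₀+1)`.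
* §3 **`exists_interior_gradient_const`** — `∃ C_d ≥ 0`: for `K ≥ 3` and `u, g, a, M_u, H` as above, every `μ`:
  `|fdiff μ u a| ≤ C_d(M_u∕K + H)` and `∀ x′ ∈ Q_{ρ₀}(a)` (`1 ≤ ρ₀ ≤ K`), `|fdiff μ u x′ − fdiff μ u a| ≤ C_d(M_u∕K + H)√(ρ₀∕K)`.
HONEST SCOPE.  [folklore] lattice analysis; constants crude; the exponent `½` is the one g94's `Hloc` delivers downstream; no estimate of print on the MODEL yet
(the transfer to `TSite`, the weighted letter and the covariant perturbation are the successor files); NOT summit progress (cell pub-balaban: NE9 NOT PRINTED ∕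
NOT PROVED; spine PROVED 0∕9; finite T⁴ — NOT infinite volume, NOT mass gap, NOT BetaPertH, NOT Clay).  NEW file importing `B4Eq19LatticeGradientCampanato`.
Net new unproved facts: 0.
-/

noncomputable section

open scoped BigOperators
open Finset

namespace Literature.MathematicalPhysics.QuantumFieldTheory.Balaban1983to89.B4Eq19LatticeInteriorGradient

open B4Eq19LatticeOperators B4Eq19LatticeBoxMeans B4Eq19LatticeGradientCampanato B4Eq19LatticeInteriorHolder

variable {d : ℕ}

/-! ## §1 Campanato ⇒ pointwise, one centre -/

/-- The elementary inequality `(a+b)² ≤ (8∕7)a² + 8b²`. [folklore] [cite: Giaquinta1984, Ch. III §1 p.71] -/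
theorem sq_add_le_eight_sevenths (a b : ℝ) : (a + b) ^ 2 ≤ 8 / 7 * a ^ 2 + 8 * b ^ 2 := by
  nlinarith [sq_nonneg (a - 7 * b)]

/-- **CAMPANATO ⇒ POINTWISE AT ONE CENTRE**: if `exc v (Q_ρ(z)) ≤ N(ρ+1)^{d+1}` for `0 ≤ ρ ≤ R₀`, then `(v z − boxAvg v z m)² ≤ 64·2^d·N·(m+1)` for every
`m ≤ R₀` (strong induction through `m′ = ⌊m∕2⌋`: `(v z − avg_{m′})² ≤ 48·2^dN(m+1)` by `m′+1 ≤ ¾(m+1)`, `(avg_{m′} − avg_m)² ≤ 2^dN(m+1)` by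
`card_mul_sq_sub_le_exc`, and `(a+b)² ≤ (8∕7)a² + 8b²`). [folklore] [cite: Giaquinta1984, Ch. III §1 Thm 1.2 pp.70–72] -/
theorem sq_sub_boxAvg_le_of_campanato (v : Zd d → ℝ) (z : Zd d) {N : ℝ} (hN : 0 ≤ N) {R₀ : ℤ}
    (hexc : ∀ ρ : ℤ, 0 ≤ ρ → ρ ≤ R₀ → exc v z ρ ≤ N * ((ρ : ℝ) + 1) ^ (d + 1)) :
    ∀ m : ℕ, (m : ℤ) ≤ R₀ → (v z - boxAvg v z m) ^ 2 ≤ 64 * 2 ^ d * N * ((m : ℝ) + 1) := by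
  intro m
  induction m using Nat.strong_induction_on with
  | _ m ih =>
    intro hmR
    have h2d : (1 : ℝ) ≤ 2 ^ d := one_le_pow₀ (by norm_num)
    by_cases hm0 : m = 0
    · subst hm0
      have h1 : (v z - boxAvg v z ((0 : ℕ) : ℤ)) ^ 2 ≤ exc v z 0 := sq_sub_boxAvg_le_exc v (self_mem_box z le_rfl)
      have h2 := hexc 0 le_rfl (by exact_mod_cast hmR)
      simp only [Int.cast_zero, zero_add, one_pow, mul_one, Nat.cast_zero] at h1 h2 ⊢
      have h3 : N ≤ 64 * 2 ^ d * N := by nlinarith [mul_nonneg (sub_nonneg.2 h2d) hN]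
      linarith
    · set m' : ℕ := m / 2 with hm'
      have hm'lt : m' < m := by omega
      have hm'le : 2 * m' ≤ m := by omega
      have hmle : m ≤ 2 * m' + 1 := by omega
      have ih' := ih m' hm'lt (le_trans (by exact_mod_cast hm'lt.le) hmR)
      -- the two pieces
      set a : ℝ := v z - boxAvg v z m' with ha
      set b : ℝ := boxAvg v z m' - boxAvg v z m with hb
      have hmR' : (m' : ℝ) + 1 ≤ 3 / 4 * ((m : ℝ) + 1) := by
        have h1 : (4 : ℝ) * m' ≤ 2 * m := by exact_mod_cast (show 4 * m' ≤ 2 * m by omega)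
        have h2 : (1 : ℝ) ≤ m := by exact_mod_cast Nat.one_le_iff_ne_zero.2 hm0
        linarith
      have ha2 : a ^ 2 ≤ 48 * 2 ^ d * N * ((m : ℝ) + 1) := by
        calc a ^ 2 ≤ 64 * 2 ^ d * N * ((m' : ℝ) + 1) := ih'
          _ ≤ 64 * 2 ^ d * N * (3 / 4 * ((m : ℝ) + 1)) := mul_le_mul_of_nonneg_left hmR' (by positivity)
          _ = 48 * 2 ^ d * N * ((m : ℝ) + 1) := by ring
      have hb2 : b ^ 2 ≤ 2 ^ d * N * ((m : ℝ) + 1) := by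
        have hsub : box z (m' : ℤ) ⊆ box z (m : ℤ) := box_mono z (by exact_mod_cast hm'lt.le)
        have hnest := card_mul_sq_sub_le_exc v hsub
        rw [card_box z (by positivity : (0 : ℤ) ≤ m')] at hnest
        have hexcm := hexc m (by positivity) hmR
        have hcard1 : ((m : ℝ) + 1) ^ d ≤ 2 ^ d * ((2 * (m' : ℤ) + 1 : ℤ) : ℝ) ^ d := by
          rw [← mul_pow]; apply pow_le_pow_left₀ (by positivity)
          push_cast
          have : (m : ℝ) ≤ 2 * m' + 1 := by exact_mod_cast hmle
          linarith
        have hcpos : (0 : ℝ) < ((2 * (m' : ℤ) + 1 : ℤ) : ℝ) ^ d := by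
          apply pow_pos; push_cast; positivity
        -- `card·b² ≤ N (m+1)^{d+1} ≤ 2^d card N (m+1)`
        have : ((2 * (m' : ℤ) + 1 : ℤ) : ℝ) ^ d * b ^ 2 ≤ ((2 * (m' : ℤ) + 1 : ℤ) : ℝ) ^ d * (2 ^ d * N * ((m : ℝ) + 1)) := by
          calc ((2 * (m' : ℤ) + 1 : ℤ) : ℝ) ^ d * b ^ 2 ≤ exc v z m := hnest
            _ ≤ N * ((m : ℝ) + 1) ^ (d + 1) := by exact_mod_cast hexcm
            _ = N * ((m : ℝ) + 1) * ((m : ℝ) + 1) ^ d := by ring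
            _ ≤ N * ((m : ℝ) + 1) * (2 ^ d * ((2 * (m' : ℤ) + 1 : ℤ) : ℝ) ^ d) := mul_le_mul_of_nonneg_left hcard1 (by positivity)
            _ = ((2 * (m' : ℤ) + 1 : ℤ) : ℝ) ^ d * (2 ^ d * N * ((m : ℝ) + 1)) := by ring
        exact le_of_mul_le_mul_left this hcpos
      have hab : v z - boxAvg v z m = a + b := by rw [ha, hb]; ring
      rw [hab]
      calc (a + b) ^ 2 ≤ 8 / 7 * a ^ 2 + 8 * b ^ 2 := sq_add_le_eight_sevenths a b
        _ ≤ 8 / 7 * (48 * 2 ^ d * N * ((m : ℝ) + 1)) + 8 * (2 ^ d * N * ((m : ℝ) + 1)) := by linarith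
        _ ≤ 64 * 2 ^ d * N * ((m : ℝ) + 1) := by nlinarith [mul_nonneg (mul_nonneg (le_trans zero_le_one h2d) hN) (by positivity : (0:ℝ) ≤ (m:ℝ) + 1)]

/-! ## §2 Two centres -/

/-- **TWO CENTRES**: `x′ ∈ Q_{ρ₀}(z)`, `1 ≤ ρ₀`, `2ρ₀ ≤ R₀`, and the Campanato bound `exc v (Q_ρ(·)) ≤ N(ρ+1)^{d+1}` (`0 ≤ ρ ≤ R₀`) at both centres ⟹
`(v x′ − v z)² ≤ 387·2^d·N·(2ρ₀+1)` (`v x′ − avg_{Q_{ρ₀}(x′)}`, `avg_{Q_{ρ₀}(x′)} − avg_{Q_{2ρ₀}(z)}` with `Q_{ρ₀}(x′) ⊆ Q_{2ρ₀}(z)`, `avg_{Q_{2ρ₀}(z)} − v z`).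
[folklore] [cite: Giaquinta1984, Ch. III §1 Thm 1.2 pp.70–72] -/
theorem sq_sub_le_of_campanato (v : Zd d → ℝ) {z x' : Zd d} {ρ₀ : ℕ} (hx' : x' ∈ box z (ρ₀ : ℤ)) {N : ℝ} (hN : 0 ≤ N)
    {R₀ : ℤ} (hR₀ : 2 * (ρ₀ : ℤ) ≤ R₀)
    (hexc_z : ∀ ρ : ℤ, 0 ≤ ρ → ρ ≤ R₀ → exc v z ρ ≤ N * ((ρ : ℝ) + 1) ^ (d + 1))
    (hexc_x : ∀ ρ : ℤ, 0 ≤ ρ → ρ ≤ R₀ → exc v x' ρ ≤ N * ((ρ : ℝ) + 1) ^ (d + 1)) :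
    (v x' - v z) ^ 2 ≤ 387 * 2 ^ d * N * (2 * (ρ₀ : ℝ) + 1) := by
  have h2d : (1 : ℝ) ≤ 2 ^ d := one_le_pow₀ (by norm_num)
  set a : ℝ := v x' - boxAvg v x' ρ₀ with ha
  set b : ℝ := boxAvg v x' ρ₀ - boxAvg v z ((2 * ρ₀ : ℕ) : ℤ) with hb
  set c : ℝ := boxAvg v z ((2 * ρ₀ : ℕ) : ℤ) - v z with hc
  have hsum : v x' - v z = a + b + c := by rw [ha, hb, hc]; ring
  have ha2 : a ^ 2 ≤ 64 * 2 ^ d * N * ((ρ₀ : ℝ) + 1) := sq_sub_boxAvg_le_of_campanato v x' hN hexc_x ρ₀ (by linarith)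
  have hc2 : c ^ 2 ≤ 64 * 2 ^ d * N * (((2 * ρ₀ : ℕ) : ℝ) + 1) := by
    rw [hc, ← neg_sub, neg_sq]; exact sq_sub_boxAvg_le_of_campanato v z hN hexc_z (2 * ρ₀) (by push_cast; exact hR₀)
  have hb2 : b ^ 2 ≤ N * (2 * (ρ₀ : ℝ) + 1) := by
    have hsub : box x' (ρ₀ : ℤ) ⊆ box z ((2 * ρ₀ : ℕ) : ℤ) := box_subset_box fun i => by
      have := (mem_box.1 hx') i; push_cast; linarith
    have hnest := card_mul_sq_sub_le_exc v hsub
    rw [card_box x' (by positivity : (0 : ℤ) ≤ ρ₀)] at hnest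
    have hexcm := hexc_z ((2 * ρ₀ : ℕ) : ℤ) (by positivity) (by push_cast; exact hR₀)
    have hcpos : (0 : ℝ) < ((2 * (ρ₀ : ℤ) + 1 : ℤ) : ℝ) ^ d := by apply pow_pos; push_cast; positivity
    have e : ((((2 * ρ₀ : ℕ) : ℤ) : ℝ) + 1) = ((2 * (ρ₀ : ℤ) + 1 : ℤ) : ℝ) := by push_cast; ring
    have : ((2 * (ρ₀ : ℤ) + 1 : ℤ) : ℝ) ^ d * b ^ 2 ≤ ((2 * (ρ₀ : ℤ) + 1 : ℤ) : ℝ) ^ d * (N * (2 * (ρ₀ : ℝ) + 1)) := by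
      calc ((2 * (ρ₀ : ℤ) + 1 : ℤ) : ℝ) ^ d * b ^ 2 ≤ exc v z ((2 * ρ₀ : ℕ) : ℤ) := hnest
        _ ≤ N * ((((2 * ρ₀ : ℕ) : ℤ) : ℝ) + 1) ^ (d + 1) := hexcm
        _ = ((2 * (ρ₀ : ℤ) + 1 : ℤ) : ℝ) ^ d * (N * (2 * (ρ₀ : ℝ) + 1)) := by rw [e, pow_succ]; push_cast; ring
    exact le_of_mul_le_mul_left this hcpos
  have hρ1 : ((ρ₀ : ℝ) + 1) ≤ 2 * (ρ₀ : ℝ) + 1 := by have : (0:ℝ) ≤ ρ₀ := Nat.cast_nonneg _; linarith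
  have hcast : (((2 * ρ₀ : ℕ) : ℝ) + 1) = 2 * (ρ₀ : ℝ) + 1 := by push_cast; ring
  rw [hcast] at hc2
  have hNρ : 0 ≤ N * (2 * (ρ₀ : ℝ) + 1) := by positivity
  rw [hsum]
  calc (a + b + c) ^ 2 ≤ 3 * (a ^ 2 + b ^ 2 + c ^ 2) := by nlinarith [sq_nonneg (a - b), sq_nonneg (b - c), sq_nonneg (a - c)]
    _ ≤ 3 * (64 * 2 ^ d * N * (2 * (ρ₀ : ℝ) + 1) + N * (2 * (ρ₀ : ℝ) + 1) + 64 * 2 ^ d * N * (2 * (ρ₀ : ℝ) + 1)) := by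
        have : 64 * 2 ^ d * N * ((ρ₀ : ℝ) + 1) ≤ 64 * 2 ^ d * N * (2 * (ρ₀ : ℝ) + 1) := mul_le_mul_of_nonneg_left hρ1 (by positivity)
        linarith
    _ ≤ 387 * 2 ^ d * N * (2 * (ρ₀ : ℝ) + 1) := by nlinarith

/-! ## §3 The interior gradient estimate -/

/-- From `s² ≤ T·P²·q` (`T, P ≥ 0`) to `|s| ≤ √T·P·√q`. [folklore] [cite: Giaquinta1984, Ch. III §1 p.72] -/
theorem abs_le_sqrt_mul_of_sq_le {s T P q : ℝ} (hT : 0 ≤ T) (hP : 0 ≤ P) (h : s ^ 2 ≤ T * P ^ 2 * q) :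
    |s| ≤ Real.sqrt T * P * Real.sqrt q := by
  have h1 : |s| ≤ Real.sqrt (T * P ^ 2 * q) := Real.abs_le_sqrt h
  have e : Real.sqrt (T * P ^ 2 * q) = Real.sqrt T * P * Real.sqrt q := by
    rw [Real.sqrt_mul (by positivity : 0 ≤ T * P ^ 2), Real.sqrt_mul hT, Real.sqrt_sq hP]
  rwa [e] at h1

/-- **THE INTERIOR GRADIENT (`C^{1,½}`) ESTIMATE ON `ℤ^d`, UNIFORM IN THE SCALE.**  There is `C_d ≥ 0` (depending only on `d ≥ 1`) such that for every `K ≥ 3`,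
every `u, g` with `(−Δ + K⁻²)u = ∂*g` and `|u| ≤ M_u` on `Q_{4K}(a)`, and `g` `½`-Hölder at scale `K` on `Q_{4K}(a)` with constant `H`
(`|g(y′,μ) − g(y,μ)| ≤ H√(s∕K)` for `y, y′ ∈ Q_{4K}(a)`, `y′ ∈ Q_s(y)`), and every direction `μ`:
`|∂_μu(a)| ≤ C_d (M_u∕K + H)` and `|∂_μu(x′) − ∂_μu(a)| ≤ C_d (M_u∕K + H) √(ρ₀∕K)` for `x′ ∈ Q_{ρ₀}(a)`, `1 ≤ ρ₀ ≤ K`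
(`exists_gradient_campanato_const` at the centres `a`, `x′ ∈ Q_K(a)`; §1–§2; the mean of `∂_μu` over `Q_{2K}(a)` by `top_scale_bound` for `g − g(a)`).
In η-units (`η = K⁻¹`): `‖∇^ηu‖`, `[∇^ηu]_{½,η}` `≤ C_d(‖u‖_∞ + H_f)` for `(Δ^η+1)u = ∇^{η*}f`, `f` η-scale `½`-Hölder of modulus `H_f`.
[folklore] [cite: Giaquinta1984, Ch. III §3 Thm 3.1–3.2 pp.84–88, §1 Thm 1.2 p.70; Balaban1984PropagatorsII, (1.9) p.226; Balaban1985BackgroundPropagators, Thm 3.1 (3.43)–(3.44) p.398] -/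
theorem exists_interior_gradient_const (d : ℕ) (hd : 1 ≤ d) : ∃ C : ℝ, 0 ≤ C ∧
    ∀ (K : ℕ), 3 ≤ K → ∀ (u : Zd d → ℝ) (g : Zd d → Fin d → ℝ) (a : Zd d) (Mu H : ℝ), 0 ≤ Mu → 0 ≤ H →
      (∀ y ∈ box a (4 * K), lop (1 / (K : ℝ) ^ 2) u y = dvg g y) →
      (∀ y ∈ box a (4 * K), |u y| ≤ Mu) →
      (∀ (s : ℕ) (y y' : Zd d), y ∈ box a (4 * K) → y' ∈ box a (4 * K) → y' ∈ box y s → ∀ μ, |g y' μ - g y μ| ≤ H * Real.sqrt (s / K)) →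
      ∀ μ : Fin d, |fdiff μ u a| ≤ C * (Mu / K + H) ∧
        ∀ (x' : Zd d) (ρ₀ : ℕ), 1 ≤ ρ₀ → ρ₀ ≤ K → x' ∈ box a (ρ₀ : ℤ) →
          |fdiff μ u x' - fdiff μ u a| ≤ C * (Mu / K + H) * Real.sqrt ((ρ₀ : ℝ) / K) := by
  obtain ⟨C₂, hC₂0, hC₂⟩ := exists_gradient_campanato_const d hd
  have hdR : (0 : ℝ) ≤ d := Nat.cast_nonneg d
  -- the constant
  set C : ℝ := Real.sqrt (192 * 2 ^ d * C₂) + Real.sqrt (126 * d * 7 ^ d) + Real.sqrt (1161 * 2 ^ d * C₂) with hC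
  refine ⟨C, by positivity, ?_⟩
  intro K hK u g a Mu H hMu hH hEq hu hg μ
  have hK3 : (3 : ℝ) ≤ K := by exact_mod_cast hK
  have hK0 : (0 : ℝ) < K := by linarith
  set E : ℝ := ((Mu / K) ^ 2 + H ^ 2) / K with hE
  have hE0 : 0 ≤ E := by positivity
  set N : ℝ := C₂ * E with hN
  have hN0 : 0 ≤ N := by positivity
  set P : ℝ := Mu / K + H with hP
  have hP0 : 0 ≤ P := by positivity
  have hEP : (Mu / K) ^ 2 + H ^ 2 ≤ P ^ 2 := by rw [hP]; nlinarith [mul_nonneg (div_nonneg hMu hK0.le) hH]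
  set v : Zd d → ℝ := fdiff μ u with hv
  -- the Campanato bound at every centre of `Q_K(a)`
  have hexc : ∀ x ∈ box a (K : ℤ), ∀ ρ : ℤ, 0 ≤ ρ → ρ ≤ 2 * (K : ℤ) → exc v x ρ ≤ N * ((ρ : ℝ) + 1) ^ (d + 1) := by
    intro x hx ρ h1 h2
    have := hC₂ K hK u g a Mu H hMu hH hEq hu hg x hx μ ρ h1 h2
    rw [hN, hE]; exact this
  have ha : a ∈ box a (K : ℤ) := self_mem_box a (by positivity)
  constructor
  · -- the sup bound at the centre
    -- (i) `v a − avg_{Q_{2K}(a)} v`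
    have h1 : (v a - boxAvg v a ((2 * K : ℕ) : ℤ)) ^ 2 ≤ 64 * 2 ^ d * N * (((2 * K : ℕ) : ℝ) + 1) :=
      sq_sub_boxAvg_le_of_campanato v a hN0 (R₀ := 2 * (K : ℤ)) (hexc a ha) (2 * K) (by push_cast; exact le_rfl)
    have h1' : (v a - boxAvg v a ((2 * K : ℕ) : ℤ)) ^ 2 ≤ (192 * 2 ^ d * C₂) * P ^ 2 * 1 := by
      have hK1 : (((2 * K : ℕ) : ℝ) + 1) ≤ 3 * K := by push_cast; linarith
      have hNE : N * (((2 * K : ℕ) : ℝ) + 1) ≤ C₂ * (3 * P ^ 2) := by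
        calc N * (((2 * K : ℕ) : ℝ) + 1) ≤ N * (3 * K) := mul_le_mul_of_nonneg_left hK1 hN0
          _ = C₂ * (3 * ((Mu / K) ^ 2 + H ^ 2)) := by rw [hN, hE]; field_simp
          _ ≤ C₂ * (3 * P ^ 2) := mul_le_mul_of_nonneg_left (by linarith) hC₂0
      calc (v a - boxAvg v a ((2 * K : ℕ) : ℤ)) ^ 2 ≤ 64 * 2 ^ d * (N * (((2 * K : ℕ) : ℝ) + 1)) := by linarith
        _ ≤ 64 * 2 ^ d * (C₂ * (3 * P ^ 2)) := mul_le_mul_of_nonneg_left hNE (by positivity)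
        _ = (192 * 2 ^ d * C₂) * P ^ 2 * 1 := by ring
    have hi := abs_le_sqrt_mul_of_sq_le (by positivity) hP0 h1'
    rw [Real.sqrt_one, mul_one] at hi
    -- (ii) the mean itself by the top scale
    have hga : ∀ y ∈ box a (4 * K), ∀ ν, |g y ν - g a ν| ≤ 2 * H := by
      intro y hy ν
      have h := hg (4 * K) a y (self_mem_box a (by positivity)) hy (by exact_mod_cast hy) ν
      have hs : Real.sqrt (((4 * K : ℕ) : ℝ) / K) = 2 := by
        rw [show (((4 * K : ℕ) : ℝ) / K) = 4 by push_cast; field_simp]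
        rw [show (4 : ℝ) = 2 ^ 2 by norm_num, Real.sqrt_sq (by norm_num)]
      rw [hs] at h; linarith
    have hEq' : ∀ y ∈ box a (4 * K), lop (1 / (K : ℝ) ^ 2) u y = dvg (fun z ν => g z ν - g a ν) y := fun y hy => by
      rw [dvg_sub_const]; exact hEq y hy
    have hTop := top_scale_bound hK u (fun z ν => g z ν - g a ν) a hEq' hu hga ha
    have hcard : ((box a (2 * (K : ℤ))).card : ℝ) = ((2 * (2 * (K : ℤ)) + 1 : ℤ) : ℝ) ^ d := card_box a (by positivity)
    have h2 : ((2 * (2 * (K : ℤ)) + 1 : ℤ) : ℝ) ^ d * boxAvg v a (2 * (K : ℤ)) ^ 2 ≤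
        126 * d * 7 ^ d * ((K : ℝ) ^ d / (K : ℝ) ^ 2) * Mu ^ 2 + 4 * d * 6 ^ d * ((K : ℝ) ^ d / (K : ℝ) ^ 2) * ((K : ℝ) * (2 * H)) ^ 2 := by
      rw [← hcard]
      calc ((box a (2 * (K : ℤ))).card : ℝ) * boxAvg v a (2 * (K : ℤ)) ^ 2 ≤ ∑ y ∈ box a (2 * (K : ℤ)), v y ^ 2 := card_mul_boxAvg_sq_le v a _
        _ ≤ gradSq u (box a (2 * (K : ℤ))) := sum_sq_fdiff_le_gradSq u _ μ
        _ ≤ _ := hTop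
    have h2' : boxAvg v a (2 * (K : ℤ)) ^ 2 ≤ (126 * d * 7 ^ d) * P ^ 2 * 1 := by
      have hKd : (K : ℝ) ^ d ≤ ((2 * (2 * (K : ℤ)) + 1 : ℤ) : ℝ) ^ d := pow_le_pow_left₀ hK0.le (by push_cast; linarith) d
      have hcpos : (0 : ℝ) < ((2 * (2 * (K : ℤ)) + 1 : ℤ) : ℝ) ^ d := by apply pow_pos; push_cast; linarith
      have e : 126 * d * 7 ^ d * ((K : ℝ) ^ d / (K : ℝ) ^ 2) * Mu ^ 2 + 4 * d * 6 ^ d * ((K : ℝ) ^ d / (K : ℝ) ^ 2) * ((K : ℝ) * (2 * H)) ^ 2 =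
          (K : ℝ) ^ d * (126 * d * 7 ^ d * (Mu / K) ^ 2 + 16 * d * 6 ^ d * H ^ 2) := by field_simp; ring
      have h67 : (16 : ℝ) * d * 6 ^ d ≤ 126 * d * 7 ^ d := by
        have h7 : (6 : ℝ) ^ d ≤ 7 ^ d := pow_le_pow_left₀ (by norm_num) (by norm_num) d
        have h7' : (0 : ℝ) ≤ d * 7 ^ d := by positivity
        calc (16 : ℝ) * d * 6 ^ d = 16 * (d * 6 ^ d) := by ring
          _ ≤ 16 * (d * 7 ^ d) := mul_le_mul_of_nonneg_left (mul_le_mul_of_nonneg_left h7 hdR) (by norm_num)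
          _ ≤ 126 * (d * 7 ^ d) := mul_le_mul_of_nonneg_right (by norm_num) h7'
          _ = 126 * d * 7 ^ d := by ring
      have hin : 126 * d * 7 ^ d * (Mu / K) ^ 2 + 16 * d * 6 ^ d * H ^ 2 ≤ (126 * d * 7 ^ d) * P ^ 2 := by
        have hH2 : 0 ≤ H ^ 2 := sq_nonneg H
        calc 126 * d * 7 ^ d * (Mu / K) ^ 2 + 16 * d * 6 ^ d * H ^ 2 ≤ 126 * d * 7 ^ d * (Mu / K) ^ 2 + 126 * d * 7 ^ d * H ^ 2 :=
              add_le_add_right (mul_le_mul_of_nonneg_right h67 hH2) _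
          _ = 126 * d * 7 ^ d * ((Mu / K) ^ 2 + H ^ 2) := by ring
          _ ≤ (126 * d * 7 ^ d) * P ^ 2 := mul_le_mul_of_nonneg_left hEP (by positivity)
      rw [e] at h2
      have h3 : ((2 * (2 * (K : ℤ)) + 1 : ℤ) : ℝ) ^ d * boxAvg v a (2 * (K : ℤ)) ^ 2 ≤ ((2 * (2 * (K : ℤ)) + 1 : ℤ) : ℝ) ^ d * ((126 * d * 7 ^ d) * P ^ 2) :=
        h2.trans (mul_le_mul hKd hin (by positivity) (by positivity))
      have := le_of_mul_le_mul_left h3 hcpos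
      linarith
    have hii := abs_le_sqrt_mul_of_sq_le (by positivity) hP0 h2'
    rw [Real.sqrt_one, mul_one] at hii
    have hsplit : |v a| ≤ |v a - boxAvg v a ((2 * K : ℕ) : ℤ)| + |boxAvg v a (2 * (K : ℤ))| := by
      have e : v a = (v a - boxAvg v a ((2 * K : ℕ) : ℤ)) + boxAvg v a (2 * (K : ℤ)) := by push_cast; ring
      conv_lhs => rw [e]
      exact abs_add_le _ _
    have hC3 : 0 ≤ Real.sqrt (1161 * 2 ^ d * C₂) * P := by positivity
    calc |v a| ≤ Real.sqrt (192 * 2 ^ d * C₂) * P + Real.sqrt (126 * d * 7 ^ d) * P := hsplit.trans (add_le_add hi hii)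
      _ ≤ C * P := by rw [hC]; nlinarith
  · -- the Hölder modulus
    intro x' ρ₀ hρ₀ hρ₀K hx'
    have hx'K : x' ∈ box a (K : ℤ) := box_mono a (by exact_mod_cast hρ₀K) hx'
    have hsq := sq_sub_le_of_campanato v hx' hN0 (R₀ := 2 * (K : ℤ)) (by linarith) (hexc a ha) (hexc x' hx'K)
    have hρ₀R : (1 : ℝ) ≤ ρ₀ := by exact_mod_cast hρ₀
    have hsq' : (v x' - v a) ^ 2 ≤ (1161 * 2 ^ d * C₂) * P ^ 2 * ((ρ₀ : ℝ) / K) := by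
      have hNE : N * (2 * (ρ₀ : ℝ) + 1) ≤ C₂ * P ^ 2 * (3 * ((ρ₀ : ℝ) / K)) := by
        calc N * (2 * (ρ₀ : ℝ) + 1) ≤ N * (3 * ρ₀) := mul_le_mul_of_nonneg_left (by linarith) hN0
          _ = C₂ * ((Mu / K) ^ 2 + H ^ 2) * (3 * ((ρ₀ : ℝ) / K)) := by rw [hN, hE]; field_simp
          _ ≤ C₂ * P ^ 2 * (3 * ((ρ₀ : ℝ) / K)) := by
              apply mul_le_mul_of_nonneg_right (mul_le_mul_of_nonneg_left hEP hC₂0) (by positivity)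
      calc (v x' - v a) ^ 2 ≤ 387 * 2 ^ d * (N * (2 * (ρ₀ : ℝ) + 1)) := by linarith
        _ ≤ 387 * 2 ^ d * (C₂ * P ^ 2 * (3 * ((ρ₀ : ℝ) / K))) := mul_le_mul_of_nonneg_left hNE (by positivity)
        _ = (1161 * 2 ^ d * C₂) * P ^ 2 * ((ρ₀ : ℝ) / K) := by ring
    have h := abs_le_sqrt_mul_of_sq_le (by positivity) hP0 hsq'
    calc |v x' - v a| ≤ Real.sqrt (1161 * 2 ^ d * C₂) * P * Real.sqrt ((ρ₀ : ℝ) / K) := h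
      _ ≤ C * P * Real.sqrt ((ρ₀ : ℝ) / K) := by
          apply mul_le_mul_of_nonneg_right _ (Real.sqrt_nonneg _)
          apply mul_le_mul_of_nonneg_right _ hP0
          rw [hC]; have := Real.sqrt_nonneg (192 * 2 ^ d * C₂); have := Real.sqrt_nonneg (126 * (d : ℝ) * 7 ^ d); linarith

end Literature.MathematicalPhysics.QuantumFieldTheory.Balaban1983to89.B4Eq19LatticeInteriorGradient

end
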